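import Literature.NumberTheory.Irrationality.RhinViola2001.GroupStructure
import Literature.NumberTheory.Irrationality.RhinViola2001.ThetaInvarianceProofs
import Literature.Analysis.SpecialFunctions.HypergeometricEulerTransformation
import HarnessLib

/-!
# Rhin–Viola 2001: the hypergeometric integral transformations `ϕ` (in `x`) and `χ` (in `z`) — PROVED

Topic `Literature/NumberTheory/Irrationality/RhinViola2001`; companion («X.lean / XProofs.lean» pattern) of
`GroupStructure.lean`, whose NAMED FACTS `hypergeometric_x` [(4.1), p. 280] and `hypergeometric_z` [p. 281]
are DISCHARGED here as `hypergeometric_x_holds` and `hypergeometric_z_holds`. Source: G. Rhin, C. Viola,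
*The group structure for ζ(3)*, Acta Arith. **97** (2001) 269–293 [RhinViola2001], §4: "the integral
transformation (4.1) … is a consequence of Euler's integral representation of the hypergeometric function and of
its symmetry in the numerator parameters" — for all parameters with (2.2)–(2.3) and the sixteen integers (2.7),
(2.8) non-negative (`Params.Admissible`, the standing assumption of §4):

* (4.1)  `I(h,j,k,l,m,q,r,s) = h! l!/(q'! r'!) · I(q', j, k, r', m, r, q, s)`, `q' = q+h−r`, `r' = r+l−q` (`ϕ`);
* p. 281 `I(h,j,k,l,m,q,r,s) = j! q!/(q'! j'!) · I(h, q', k, l, m, j', r, s)`, `j' = j+r−h` (`χ`).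

Together with `invariance_sigma` (PROVED in `GroupStructure.lean`) and `invariance_theta_holds` (the birational map
`ϑ`, PROVED in the sibling `ThetaInvarianceProofs.lean` by the cell's seat ct-1 g29, p542151) ALL FOUR generators
`ϕ, χ, ϑ, σ` of the Rhin–Viola group `Φ` act on the integrals (2.1) by theorems of the tree, and the last section
records the consequence: **the transformation formula (4.4)** `I(h,…,s)/(h!⋯s!) = I(ϱ(h),…,ϱ(s))/(ϱ(h)!⋯ϱ(s)!)` for
EVERY word `ϱ` in the generators, UNCONDITIONALLY (`normI_act_holds` = `GroupStructure.normI_act` fed with the three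
discharged generator statements; `normI_act_gen_holds` for one generator).

## The proof (a known argument, formalised; no new statement)

1. `euler_exchange` — the one-variable identity behind both: for `a, b, c ∈ ℕ`, `c ≤ a + b`, real `w < 1`,
   `c! (a+b−c)! ∫₀¹ x^a(1−x)^b (1−wx)^{−c−1} dx = a! b! ∫₀¹ x^c(1−x)^{a+b−c}(1−wx)^{−a−1} dx`.
   This is `E(c+1, a+1; a+b+2; w) = E(a+1, c+1; a+b+2; w)` for Euler's hypergeometric function
   `E(A,B;C;w) = Γ(C)/(Γ(B)Γ(C−B)) ∫₀¹ t^{B−1}(1−t)^{C−B−1}(1−wt)^{−A} dt` — the tree's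
   `Hypergeometric.eulerHypergeometric_symm` (`Literature/Analysis/SpecialFunctions/HypergeometricEulerTransformation.lean`,
   symmetry of `₂F₁` in its numerator parameters, continued from the disc to `Re w < 1`) — read at natural
   parameters (`Γ(n+1) = n!`, `cpow_natCast`).
2. In (2.1) the denominator factorises as `1 − (1−xy)z = (1−z)(1 − wx)` with `w = −yz/(1−z) < 0` (for `ϕ`),
   and is `1 − wz` with `w = 1 − xy ∈ (0,1)` (for `χ`); the remaining factors do not depend on the inner variable,
   and for `ϕ` the powers of `1 − z` recombine because `q + h = r + q'`.
3. Tonelli on `(0,1)³` with the inner variable innermost (Mathlib's `lmarginal`, peeled in the order `y, z, x`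
   resp. `x, y, z`), for the NON-NEGATIVE integrands in `ℝ≥0∞`; the Bochner integrals `I(…)` of
   `GroupStructure.lean` are the real parts of these lower integrals (`integral_eq_lintegral_of_nonneg_ae`), so
   NO integrability / convergence hypothesis is needed or used: the identities hold as stated, finite or not.
   Integer exponents are read as natural numbers under `Admissible` (`Int.eq_ofNat_of_zero_le`).

HONEST FRAMING (cells pub-zeta5 / zeta5-irr): identities between (possibly infinite) integrals of non-negative
functions; nothing here is an irrationality statement, a measure, or a denominator claim; nothing about `ζ(5)`;
records in print unmoved. All helper lemmas are `private`; the only new definition is the private plumbing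
function `rvF` (the integrand (2.1) with natural exponents).
-/

noncomputable section

open MeasureTheory Set intervalIntegral
open scoped Nat

namespace Literature.NumberTheory.Irrationality.RhinViola2001

open Literature.Analysis.SpecialFunctions.Hypergeometric

/-! ### Euler's exchange in one variable -/

/-- Euler's integrand at natural-number parameters `A = c+1`, `B = a+1`, `C = a+b+2` and real `w` is the real
function `x^a (1−x)^b / (1 − w x)^{c+1}`. [folklore] -/
private theorem eulerIntegrand_nat (a b c : ℕ) (hc : c ≤ a + b) (w x : ℝ) :
    eulerIntegrand ((c : ℂ) + 1) ((a : ℂ) + 1) ((a : ℂ) + b + 2) (w : ℂ) x =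
      ((x ^ a * (1 - x) ^ b / (1 - w * x) ^ (c + 1) : ℝ) : ℂ) := by
  have _ := hc
  simp only [eulerIntegrand]
  have e1 : ((a : ℂ) + 1) - 1 = (a : ℂ) := by ring
  have e2 : ((a : ℂ) + b + 2) - ((a : ℂ) + 1) - 1 = (b : ℂ) := by ring
  have e3 : -((c : ℂ) + 1) = -((c + 1 : ℕ) : ℂ) := by push_cast; ring
  rw [e1, e2, e3, Complex.cpow_natCast, Complex.cpow_natCast, Complex.cpow_neg, Complex.cpow_natCast]
  push_cast
  ring

/-- The same with the roles of `A` and `B` exchanged: `x^c (1−x)^{a+b−c} / (1 − w x)^{a+1}`. [folklore] -/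
private theorem eulerIntegrand_nat' (a b c : ℕ) (hc : c ≤ a + b) (w x : ℝ) :
    eulerIntegrand ((a : ℂ) + 1) ((c : ℂ) + 1) ((a : ℂ) + b + 2) (w : ℂ) x =
      ((x ^ c * (1 - x) ^ (a + b - c) / (1 - w * x) ^ (a + 1) : ℝ) : ℂ) := by
  simp only [eulerIntegrand]
  have e1 : ((c : ℂ) + 1) - 1 = (c : ℂ) := by ring
  have e2 : ((a : ℂ) + b + 2) - ((c : ℂ) + 1) - 1 = ((a + b - c : ℕ) : ℂ) := by
    rw [Nat.cast_sub hc]; push_cast; ring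
  have e3 : -((a : ℂ) + 1) = -((a + 1 : ℕ) : ℂ) := by push_cast; ring
  rw [e1, e2, e3, Complex.cpow_natCast, Complex.cpow_natCast, Complex.cpow_neg, Complex.cpow_natCast]
  push_cast
  ring

/-- **Euler's exchange** (the `a ↔ b` symmetry of `₂F₁` read on Euler's integral): for `a, b, c ∈ ℕ` with
`c ≤ a + b` and real `w < 1`,
`c! (a+b−c)! ∫₀¹ x^a(1−x)^b/(1−wx)^{c+1} dx = a! b! ∫₀¹ x^c(1−x)^{a+b−c}/(1−wx)^{a+1} dx`.
[cite: RhinViola2001, §4 p. 280 ("Euler's integral representation … and its symmetry")] -/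
private theorem euler_exchange (a b c : ℕ) (hc : c ≤ a + b) {w : ℝ} (hw : w < 1) :
    ((c ! : ℝ) * ((a + b - c) ! : ℝ)) * ∫ x in (0:ℝ)..1, x ^ a * (1 - x) ^ b / (1 - w * x) ^ (c + 1) =
      ((a ! : ℝ) * (b ! : ℝ)) * ∫ x in (0:ℝ)..1, x ^ c * (1 - x) ^ (a + b - c) / (1 - w * x) ^ (a + 1) := by
  set L : ℝ := ∫ x in (0:ℝ)..1, x ^ a * (1 - x) ^ b / (1 - w * x) ^ (c + 1) with hLdef
  set R : ℝ := ∫ x in (0:ℝ)..1, x ^ c * (1 - x) ^ (a + b - c) / (1 - w * x) ^ (a + 1) with hRdef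
  have hA : 0 < ((c : ℂ) + 1).re := by simp; positivity
  have hAC : ((c : ℂ) + 1).re < ((a : ℂ) + b + 2).re := by
    simp
    have : (c : ℝ) ≤ (a : ℝ) + b := by exact_mod_cast hc
    linarith
  have hB : 0 < ((a : ℂ) + 1).re := by simp; positivity
  have hBC : ((a : ℂ) + 1).re < ((a : ℂ) + b + 2).re := by
    simp
    have : (0 : ℝ) ≤ b := by positivity
    linarith
  have hz : ((w : ℂ)).re < 1 := by simpa using hw
  have hsymm := eulerHypergeometric_symm hA hAC hB hBC hz
  unfold eulerHypergeometric eulerIntegral at hsymm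
  have hGC : Complex.Gamma ((a : ℂ) + b + 2) = (((a + b + 1) ! : ℕ) : ℂ) := by
    have : ((a : ℂ) + b + 2) = ((a + b + 1 : ℕ) : ℂ) + 1 := by push_cast; ring
    rw [this, Complex.Gamma_nat_eq_factorial]
  have hGB : Complex.Gamma ((a : ℂ) + 1) = ((a ! : ℕ) : ℂ) := Complex.Gamma_nat_eq_factorial a
  have hGA : Complex.Gamma ((c : ℂ) + 1) = ((c ! : ℕ) : ℂ) := Complex.Gamma_nat_eq_factorial c
  have hGCB : Complex.Gamma ((a : ℂ) + b + 2 - ((a : ℂ) + 1)) = ((b ! : ℕ) : ℂ) := by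
    have : ((a : ℂ) + b + 2 - ((a : ℂ) + 1)) = (b : ℂ) + 1 := by ring
    rw [this, Complex.Gamma_nat_eq_factorial]
  have hGCA : Complex.Gamma ((a : ℂ) + b + 2 - ((c : ℂ) + 1)) = (((a + b - c) ! : ℕ) : ℂ) := by
    have : ((a : ℂ) + b + 2 - ((c : ℂ) + 1)) = ((a + b - c : ℕ) : ℂ) + 1 := by
      rw [Nat.cast_sub hc]; push_cast; ring
    rw [this, Complex.Gamma_nat_eq_factorial]
  have hL : (∫ x in (0:ℝ)..1, eulerIntegrand ((c : ℂ) + 1) ((a : ℂ) + 1) ((a : ℂ) + b + 2) (w : ℂ) x) =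
      (L : ℂ) := by
    rw [hLdef, ← intervalIntegral.integral_ofReal]
    exact intervalIntegral.integral_congr fun x _ => eulerIntegrand_nat a b c hc w x
  have hR : (∫ x in (0:ℝ)..1, eulerIntegrand ((a : ℂ) + 1) ((c : ℂ) + 1) ((a : ℂ) + b + 2) (w : ℂ) x) =
      (R : ℂ) := by
    rw [hRdef, ← intervalIntegral.integral_ofReal]
    exact intervalIntegral.integral_congr fun x _ => eulerIntegrand_nat' a b c hc w x
  rw [hGC, hGB, hGA, hGCB, hGCA, hL, hR] at hsymm
  have hF : (((a + b + 1) ! : ℕ) : ℂ) ≠ 0 := Nat.cast_ne_zero.mpr (Nat.factorial_ne_zero _)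
  have ha : ((a ! : ℕ) : ℂ) ≠ 0 := Nat.cast_ne_zero.mpr (Nat.factorial_ne_zero _)
  have hb : ((b ! : ℕ) : ℂ) ≠ 0 := Nat.cast_ne_zero.mpr (Nat.factorial_ne_zero _)
  have hc' : ((c ! : ℕ) : ℂ) ≠ 0 := Nat.cast_ne_zero.mpr (Nat.factorial_ne_zero _)
  have hd : (((a + b - c) ! : ℕ) : ℂ) ≠ 0 := Nat.cast_ne_zero.mpr (Nat.factorial_ne_zero _)
  field_simp at hsymm
  have key' : (((a + b + 1) ! : ℕ) : ℂ) * (((c ! : ℕ) : ℂ) * (((a + b - c) ! : ℕ) : ℂ) * (L : ℂ)) =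
      (((a + b + 1) ! : ℕ) : ℂ) * (((a ! : ℕ) : ℂ) * ((b ! : ℕ) : ℂ) * (R : ℂ)) := by
    linear_combination ((((a + b + 1) ! : ℕ) : ℂ)) * hsymm
  have key := mul_left_cancel₀ hF key'
  exact_mod_cast key


/-! ### The integrand (2.1) with natural exponents, and the inner `x`-integral -/

/-- The integrand (2.1) with natural-number exponents as a function of `(x, y, z)`:
`x^a (1−x)^b y^k (1−y)^s z^j (1−z)^q / (1 − (1−xy)z)^{n+1}` (plumbing for the proof of (4.1)).
[cite: RhinViola2001, §2 (2.1)] -/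
private def rvF (a b k s j q n : ℕ) (x y z : ℝ) : ℝ :=
  x ^ a * (1 - x) ^ b * y ^ k * (1 - y) ^ s * z ^ j * (1 - z) ^ q / (1 - (1 - x * y) * z) ^ (n + 1)

/-- On `[0,1] × (0,1) × (0,1)` the denominator `1 − (1 − xy)z` is positive. [folklore] -/
private theorem rv_den_pos {x y z : ℝ} (hx0 : 0 ≤ x) (hx1 : x ≤ 1) (hy0 : 0 < y) (hy1 : y < 1)
    (hz0 : 0 < z) (hz1 : z < 1) : 0 < 1 - (1 - x * y) * z := by
  have hxy : 0 ≤ x * y := mul_nonneg hx0 hy0.le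
  have hxy1 : x * y ≤ 1 := by nlinarith
  nlinarith [mul_nonneg hxy hz0.le]

/-- The factorisation `1 − (1 − xy)z = (1 − z)(1 − w x)` with `w = −yz/(1−z)`. [folklore] -/
private theorem rv_den_factor (x y : ℝ) {z : ℝ} (hz1 : z < 1) :
    1 - (1 - x * y) * z = (1 - z) * (1 - (-(y * z) / (1 - z)) * x) := by
  have hz : (1 - z) ≠ 0 := by linarith
  field_simp
  ring

/-- `rvF` is non-negative on `[0,1] × (0,1) × (0,1)`. [folklore] -/
private theorem rvF_nonneg (a b k s j q n : ℕ) {x y z : ℝ} (hx0 : 0 ≤ x) (hx1 : x ≤ 1) (hy0 : 0 < y)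
    (hy1 : y < 1) (hz0 : 0 < z) (hz1 : z < 1) : 0 ≤ rvF a b k s j q n x y z := by
  unfold rvF
  have hD := rv_den_pos hx0 hx1 hy0 hy1 hz0 hz1
  have h1x : 0 ≤ 1 - x := by linarith
  have h1y : 0 ≤ 1 - y := by linarith
  have h1z : 0 ≤ 1 - z := by linarith
  apply div_nonneg
  · exact mul_nonneg (mul_nonneg (mul_nonneg (mul_nonneg (mul_nonneg (pow_nonneg hx0 _)
      (pow_nonneg h1x _)) (pow_nonneg hy0.le _)) (pow_nonneg h1y _)) (pow_nonneg hz0.le _)) (pow_nonneg h1z _)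
  · exact (pow_pos hD _).le

/-- `x ↦ rvF … x y z` is continuous on `[0,1]` for `(y, z) ∈ (0,1)²`. [folklore] -/
private theorem continuousOn_rvF (a b k s j q n : ℕ) {y z : ℝ} (hy0 : 0 < y) (hy1 : y < 1) (hz0 : 0 < z)
    (hz1 : z < 1) : ContinuousOn (fun x => rvF a b k s j q n x y z) (uIcc (0 : ℝ) 1) := by
  unfold rvF
  refine ContinuousOn.div (by fun_prop) (by fun_prop) fun x hx => ?_
  rw [uIcc_of_le zero_le_one, mem_Icc] at hx
  exact (pow_pos (rv_den_pos hx.1 hx.2 hy0 hy1 hz0 hz1) _).ne'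

/-- `x ↦ rvF … x y z` is interval integrable on `[0,1]` for `(y, z) ∈ (0,1)²`. [folklore] -/
private theorem intervalIntegrable_rvF (a b k s j q n : ℕ) {y z : ℝ} (hy0 : 0 < y) (hy1 : y < 1)
    (hz0 : 0 < z) (hz1 : z < 1) : IntervalIntegrable (fun x => rvF a b k s j q n x y z) volume 0 1 :=
  (continuousOn_rvF a b k s j q n hy0 hy1 hz0 hz1).intervalIntegrable

/-- The inner `x`-integral factorises: `∫₀¹ rvF = K(y,z) · ∫₀¹ x^a(1−x)^b/(1−wx)^{n+1}` with
`K = y^k(1−y)^s z^j(1−z)^q/(1−z)^{n+1}`, `w = −yz/(1−z)`. [folklore] -/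
private theorem inner_integral_rvF (a b k s j q n : ℕ) {y z : ℝ} (hz1 : z < 1) :
    ∫ x in (0:ℝ)..1, rvF a b k s j q n x y z =
      (y ^ k * (1 - y) ^ s * z ^ j * (1 - z) ^ q / (1 - z) ^ (n + 1)) *
        ∫ x in (0:ℝ)..1, x ^ a * (1 - x) ^ b / (1 - (-(y * z) / (1 - z)) * x) ^ (n + 1) := by
  rw [← intervalIntegral.integral_const_mul]
  refine intervalIntegral.integral_congr fun x _ => ?_
  simp only [rvF]
  rw [rv_den_factor x y hz1, mul_pow]
  have hz : (1 - z) ^ (n + 1) ≠ 0 := pow_ne_zero _ (by linarith)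
  field_simp

/-- **The inner identity**: for `(y,z) ∈ (0,1)²`, `c ≤ a + b` and `q + a = r + c`,
`c!(a+b−c)! ∫₀¹ rvF(a,b,k,s,j,q;c) dx = a! b! ∫₀¹ rvF(c,a+b−c,k,s,j,r;a) dx` (Euler's exchange in `x`).
[cite: RhinViola2001, §4 (4.1), p. 280] -/
private theorem inner_exchange (a b c k s j q r : ℕ) (hc : c ≤ a + b) (hrel : q + a = r + c) {y z : ℝ}
    (hy0 : 0 < y) (hy1 : y < 1) (hz0 : 0 < z) (hz1 : z < 1) :
    ((c ! : ℝ) * ((a + b - c) ! : ℝ)) * ∫ x in (0:ℝ)..1, rvF a b k s j q c x y z =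
      ((a ! : ℝ) * (b ! : ℝ)) * ∫ x in (0:ℝ)..1, rvF c (a + b - c) k s j r a x y z := by
  have _ := hy1
  rw [inner_integral_rvF a b k s j q c hz1, inner_integral_rvF c (a + b - c) k s j r a hz1]
  have hw : -(y * z) / (1 - z) < 1 := by
    have h1z : 0 < 1 - z := by linarith
    have : -(y * z) / (1 - z) ≤ 0 := div_nonpos_of_nonpos_of_nonneg (by nlinarith [mul_pos hy0 hz0]) h1z.le
    linarith
  have hE := euler_exchange a b c hc hw
  -- the two prefactors agree: (1−z)^q/(1−z)^{c+1} = (1−z)^r/(1−z)^{a+1}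
  have h1z : (1 - z) ≠ 0 := by linarith
  have hK : y ^ k * (1 - y) ^ s * z ^ j * (1 - z) ^ q / (1 - z) ^ (c + 1) =
      y ^ k * (1 - y) ^ s * z ^ j * (1 - z) ^ r / (1 - z) ^ (a + 1) := by
    rw [div_eq_div_iff (pow_ne_zero _ h1z) (pow_ne_zero _ h1z)]
    have : (1 - z) ^ q * (1 - z) ^ (a + 1) = (1 - z) ^ r * (1 - z) ^ (c + 1) := by
      rw [← pow_add, ← pow_add, show q + (a + 1) = r + (c + 1) by omega]
    calc y ^ k * (1 - y) ^ s * z ^ j * (1 - z) ^ q * (1 - z) ^ (a + 1)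
        = y ^ k * (1 - y) ^ s * z ^ j * ((1 - z) ^ q * (1 - z) ^ (a + 1)) := by ring
      _ = y ^ k * (1 - y) ^ s * z ^ j * ((1 - z) ^ r * (1 - z) ^ (c + 1)) := by rw [this]
      _ = y ^ k * (1 - y) ^ s * z ^ j * (1 - z) ^ r * (1 - z) ^ (c + 1) := by ring
  rw [← hK]
  set K := y ^ k * (1 - y) ^ s * z ^ j * (1 - z) ^ q / (1 - z) ^ (c + 1)
  set L := ∫ x in (0:ℝ)..1, x ^ a * (1 - x) ^ b / (1 - (-(y * z) / (1 - z)) * x) ^ (c + 1)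
  set R := ∫ x in (0:ℝ)..1, x ^ c * (1 - x) ^ (a + b - c) / (1 - (-(y * z) / (1 - z)) * x) ^ (a + 1)
  linear_combination K * hE

/-! ### From interval integrals to lower Lebesgue integrals -/

/-- `∫⁻` over `(0,1)` of `ofReal ∘ f` is `ofReal` of the interval integral, for `f` interval integrable and
nonnegative on `(0,1)`. [folklore] -/
private theorem setLIntegral_Ioo_ofReal' {f : ℝ → ℝ} (hint : IntervalIntegrable f volume 0 1)
    (hnn : ∀ x ∈ Ioo (0 : ℝ) 1, 0 ≤ f x) :
    ∫⁻ x in Ioo (0 : ℝ) 1, ENNReal.ofReal (f x) = ENNReal.ofReal (∫ x in (0 : ℝ)..1, f x) := by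
  rw [intervalIntegral.integral_of_le zero_le_one, integral_Ioc_eq_integral_Ioo,
    ofReal_integral_eq_lintegral_ofReal]
  · exact (intervalIntegrable_iff_integrableOn_Ioo_of_le zero_le_one).1 hint
  · exact (ae_restrict_iff' measurableSet_Ioo).2 (Filter.Eventually.of_forall hnn)

/-- The inner identity at the level of lower Lebesgue integrals. [cite: RhinViola2001, §4 (4.1), p. 280] -/
private theorem inner_lintegral_exchange (a b c k s j q r : ℕ) (hc : c ≤ a + b) (hrel : q + a = r + c)
    {y z : ℝ} (hy : y ∈ Ioo (0 : ℝ) 1) (hz : z ∈ Ioo (0 : ℝ) 1) :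
    ∫⁻ x in Ioo (0 : ℝ) 1, ENNReal.ofReal (rvF a b k s j q c x y z) =
      ENNReal.ofReal (((a ! : ℝ) * (b ! : ℝ)) / ((c ! : ℝ) * ((a + b - c) ! : ℝ))) *
        ∫⁻ x in Ioo (0 : ℝ) 1, ENNReal.ofReal (rvF c (a + b - c) k s j r a x y z) := by
  rw [setLIntegral_Ioo_ofReal' (intervalIntegrable_rvF a b k s j q c hy.1 hy.2 hz.1 hz.2)
      (fun x hx => rvF_nonneg a b k s j q c hx.1.le hx.2.le hy.1 hy.2 hz.1 hz.2),
    setLIntegral_Ioo_ofReal' (intervalIntegrable_rvF c (a + b - c) k s j r a hy.1 hy.2 hz.1 hz.2)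
      (fun x hx => rvF_nonneg c (a + b - c) k s j r a hx.1.le hx.2.le hy.1 hy.2 hz.1 hz.2),
    ← ENNReal.ofReal_mul (by positivity)]
  congr 1
  have hE := inner_exchange a b c k s j q r hc hrel hy.1 hy.2 hz.1 hz.2
  have hcd : ((c ! : ℝ) * ((a + b - c) ! : ℝ)) ≠ 0 := by positivity
  field_simp
  linear_combination hE

/-! ### Tonelli on the cube with the `x`-integral innermost -/

/-- Iterated-integral (Tonelli) form of a lower Lebesgue integral over `Fin 3 → ℝ` against a product measure,
with the first coordinate innermost (Mathlib's `lmarginal` peeled in the order `1, 2, 0`). [folklore] -/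
private theorem lintegral_pi_fin_three_x_inner (ν : Measure ℝ) [SigmaFinite ν]
    {f : (Fin 3 → ℝ) → ENNReal} (hf : Measurable f) :
    ∫⁻ p, f p ∂Measure.pi (fun _ : Fin 3 => ν) = ∫⁻ y, ∫⁻ z, ∫⁻ x, f ![x, y, z] ∂ν ∂ν ∂ν := by
  rw [lintegral_eq_lmarginal_univ (fun _ => (0 : ℝ))]
  have huniv : (Finset.univ : Finset (Fin 3)) = {1, 2, 0} := by
    ext i; fin_cases i <;> simp
  rw [huniv, lmarginal_insert f hf (i := (1 : Fin 3)) (s := {2, 0}) (by decide)]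
  refine lintegral_congr fun y => ?_
  rw [lmarginal_insert f hf (i := (2 : Fin 3)) (s := {0}) (by decide)]
  refine lintegral_congr fun z => ?_
  rw [lmarginal_singleton]
  refine lintegral_congr fun x => ?_
  congr 1
  ext i; fin_cases i <;> simp

/-- `rvF` read on a point of `ℝ³` is measurable (after `ENNReal.ofReal`). [folklore] -/
private theorem measurable_ofReal_rvF (a b k s j q n : ℕ) :
    Measurable fun p : Fin 3 → ℝ => ENNReal.ofReal (rvF a b k s j q n (p 0) (p 1) (p 2)) := by
  unfold rvF
  fun_prop

/-- **The cube identity**: `∫⁻_{(0,1)³} rvF(a,b,k,s,j,q;c) = (a!b!/(c!(a+b−c)!)) ∫⁻_{(0,1)³} rvF(c,a+b−c,k,s,j,r;a)`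
(Tonelli with the `x`-integral innermost, then the inner identity). [cite: RhinViola2001, §4 (4.1), p. 280] -/
private theorem cube_lintegral_exchange (a b c k s j q r : ℕ) (hc : c ≤ a + b) (hrel : q + a = r + c) :
    ∫⁻ p in cube, ENNReal.ofReal (rvF a b k s j q c (p 0) (p 1) (p 2)) =
      ENNReal.ofReal (((a ! : ℝ) * (b ! : ℝ)) / ((c ! : ℝ) * ((a + b - c) ! : ℝ))) *
        ∫⁻ p in cube, ENNReal.ofReal (rvF c (a + b - c) k s j r a (p 0) (p 1) (p 2)) := by
  have hS : cube = Set.pi univ (fun _ => Ioo (0 : ℝ) 1) := by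
    ext p; simp [cube]
  have hrestrict : (volume : Measure (Fin 3 → ℝ)).restrict cube
      = Measure.pi (fun _ : Fin 3 => (volume : Measure ℝ).restrict (Ioo (0 : ℝ) 1)) := by
    rw [hS, volume_pi, Measure.restrict_pi_pi]
  rw [hrestrict, lintegral_pi_fin_three_x_inner _ (measurable_ofReal_rvF a b k s j q c),
    lintegral_pi_fin_three_x_inner _ (measurable_ofReal_rvF c (a + b - c) k s j r a)]
  simp only [Matrix.cons_val_zero, Matrix.cons_val_one, Matrix.cons_val_two, Matrix.head_cons,
    Matrix.tail_cons]
  rw [← lintegral_const_mul' _ _ ENNReal.ofReal_ne_top]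
  refine setLIntegral_congr_fun measurableSet_Ioo fun y hy => ?_
  rw [← lintegral_const_mul' _ _ ENNReal.ofReal_ne_top]
  refine setLIntegral_congr_fun measurableSet_Ioo fun z hz => ?_
  exact inner_lintegral_exchange a b c k s j q r hc hrel hy hz

/-- The Bochner integral of `rvF` over the cube is the real part of the lower Lebesgue integral. [folklore] -/
private theorem integral_cube_rvF (a b k s j q n : ℕ) :
    ∫ p in cube, rvF a b k s j q n (p 0) (p 1) (p 2) =
      (∫⁻ p in cube, ENNReal.ofReal (rvF a b k s j q n (p 0) (p 1) (p 2))).toReal := by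
  have hSmeas : MeasurableSet cube := by
    have : cube = Set.pi univ (fun _ => Ioo (0 : ℝ) 1) := by ext p; simp [cube]
    rw [this]
    exact MeasurableSet.univ_pi fun _ => measurableSet_Ioo
  have hnn : 0 ≤ᵐ[volume.restrict cube] fun p : Fin 3 → ℝ => rvF a b k s j q n (p 0) (p 1) (p 2) := by
    filter_upwards [ae_restrict_mem hSmeas] with p hp
    have h0 := hp 0
    have h1 := hp 1
    have h2 := hp 2
    simp only [mem_Ioo] at h0 h1 h2
    exact rvF_nonneg a b k s j q n h0.1.le h0.2.le h1.1 h1.2 h2.1 h2.2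
  have hmeas : AEStronglyMeasurable (fun p : Fin 3 → ℝ => rvF a b k s j q n (p 0) (p 1) (p 2))
      (volume.restrict cube) := by
    refine (show Measurable _ by unfold rvF; fun_prop).aestronglyMeasurable
  exact integral_eq_lintegral_of_nonneg_ae hnn hmeas

/-! ### The discharge of `hypergeometric_x` -/

/-- **The hypergeometric transformation in `x`, (4.1) — PROVED** (discharge of the named fact
`hypergeometric_x`): for admissible parameters,
`I(h,j,k,l,m,q,r,s) = h! l!/(q'! r'!) · I(q', j, k, r', m, r, q, s)`, `q' = q+h−r`, `r' = r+l−q`, by Euler's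
integral for `₂F₁` and its symmetry in the numerator parameters (the tree's
`Hypergeometric.eulerHypergeometric_symm`) applied in the variable `x`, Tonelli on the cube, no integrability
hypothesis (both sides are integrals of non-negative functions). [cite: RhinViola2001, §4 (4.1), p. 280] -/
theorem hypergeometric_x_holds : hypergeometric_x := by
  intro P hP
  obtain ⟨⟨hb1, hb2⟩, hnn, haux⟩ := hP
  obtain ⟨h, j, k, l, m, q, r, s⟩ := P
  simp only [Params.Nonneg, Params.aux] at hnn haux hb1 hb2
  obtain ⟨h0, j0, k0, l0, m0, q0, r0, s0⟩ := hnn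
  obtain ⟨-, -, -, -, -, aq0, ar0, -⟩ := haux
  obtain ⟨a, rfl⟩ := Int.eq_ofNat_of_zero_le h0
  obtain ⟨jj, rfl⟩ := Int.eq_ofNat_of_zero_le j0
  obtain ⟨kk, rfl⟩ := Int.eq_ofNat_of_zero_le k0
  obtain ⟨b, rfl⟩ := Int.eq_ofNat_of_zero_le l0
  obtain ⟨mm, rfl⟩ := Int.eq_ofNat_of_zero_le m0
  obtain ⟨qq, rfl⟩ := Int.eq_ofNat_of_zero_le q0
  obtain ⟨rr, rfl⟩ := Int.eq_ofNat_of_zero_le r0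
  obtain ⟨ss, rfl⟩ := Int.eq_ofNat_of_zero_le s0
  -- the natural exponents of the transformed integral
  set c : ℕ := qq + a - rr with hcdef
  have hc : c ≤ a + b := by omega
  have hrel : qq + a = rr + c := by omega
  have ec : (qq : ℤ) + a - rr = (c : ℤ) := by omega
  have ed : (rr : ℤ) + jj - ss = ((a + b - c : ℕ) : ℤ) := by omega
  -- the two integrands, read with natural exponents
  have hIP : integrand ⟨a, jj, kk, b, mm, qq, rr, ss⟩ = fun p => rvF a b kk ss jj qq c (p 0) (p 1) (p 2) := by
    funext p
    have e : (qq : ℤ) + a - rr + 1 = ((c + 1 : ℕ) : ℤ) := by omega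
    simp only [integrand, rvF, e, zpow_natCast]
  have hIphi : integrand (phi ⟨a, jj, kk, b, mm, qq, rr, ss⟩) =
      fun p => rvF c (a + b - c) kk ss jj rr a (p 0) (p 1) (p 2) := by
    funext p
    have e : (rr : ℤ) + ((qq : ℤ) + a - rr) - qq + 1 = ((a + 1 : ℕ) : ℤ) := by omega
    simp only [integrand, phi, Params.aux, rvF, ec, ed, zpow_natCast]
    simp only [← ec, e, zpow_natCast]
  -- the factorials
  have hfa : (a : ℤ).toNat = a := Int.toNat_natCast a
  have hfb : (b : ℤ).toNat = b := Int.toNat_natCast b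
  have hfc : ((qq : ℤ) + a - rr).toNat = c := by rw [ec, Int.toNat_natCast]
  have hfd : ((rr : ℤ) + jj - ss).toNat = a + b - c := by rw [ed, Int.toNat_natCast]
  simp only [Params.aux, hfa, hfb, hfc, hfd, I]
  rw [hIP, hIphi, integral_cube_rvF, integral_cube_rvF, cube_lintegral_exchange a b c kk ss jj qq rr hc hrel,
    ENNReal.toReal_mul, ENNReal.toReal_ofReal (by positivity)]
  push_cast
  ring


/-! ### The transformation in `z`: the same exchange with the `z`-integral innermost -/

/-- On `(0,1) × (0,1) × [0,1]` the denominator `1 − (1 − xy)z` is positive. [folklore] -/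
private theorem rv_den_pos_z {x y z : ℝ} (hx0 : 0 < x) (hx1 : x < 1) (hy0 : 0 < y) (hy1 : y < 1)
    (hz1 : z ≤ 1) : 0 < 1 - (1 - x * y) * z := by
  have hxy : 0 < x * y := mul_pos hx0 hy0
  have hxy1 : x * y < 1 := by nlinarith
  nlinarith [mul_nonneg (sub_nonneg.2 hxy1.le) (sub_nonneg.2 hz1)]

/-- `rvF` is non-negative on `(0,1) × (0,1) × [0,1]`. [folklore] -/
private theorem rvF_nonneg_z (a b k s j q n : ℕ) {x y z : ℝ} (hx0 : 0 < x) (hx1 : x < 1) (hy0 : 0 < y)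
    (hy1 : y < 1) (hz0 : 0 ≤ z) (hz1 : z ≤ 1) : 0 ≤ rvF a b k s j q n x y z := by
  unfold rvF
  have hD := rv_den_pos_z hx0 hx1 hy0 hy1 hz1
  have h1x : 0 ≤ 1 - x := by linarith
  have h1y : 0 ≤ 1 - y := by linarith
  have h1z : 0 ≤ 1 - z := by linarith
  apply div_nonneg
  · exact mul_nonneg (mul_nonneg (mul_nonneg (mul_nonneg (mul_nonneg (pow_nonneg hx0.le _)
      (pow_nonneg h1x _)) (pow_nonneg hy0.le _)) (pow_nonneg h1y _)) (pow_nonneg hz0 _)) (pow_nonneg h1z _)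
  · exact (pow_pos hD _).le

/-- `z ↦ rvF … x y z` is interval integrable on `[0,1]` for `(x, y) ∈ (0,1)²`. [folklore] -/
private theorem intervalIntegrable_rvF_z (a b k s j q n : ℕ) {x y : ℝ} (hx0 : 0 < x) (hx1 : x < 1)
    (hy0 : 0 < y) (hy1 : y < 1) : IntervalIntegrable (fun z => rvF a b k s j q n x y z) volume 0 1 := by
  refine ContinuousOn.intervalIntegrable ?_
  unfold rvF
  refine ContinuousOn.div (by fun_prop) (by fun_prop) fun z hz => ?_
  rw [uIcc_of_le zero_le_one, mem_Icc] at hz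
  exact (pow_pos (rv_den_pos_z hx0 hx1 hy0 hy1 hz.2) _).ne'

/-- The inner `z`-integral factorises: `∫₀¹ rvF dz = x^a(1−x)^b y^k(1−y)^s · ∫₀¹ z^j(1−z)^q/(1−(1−xy)z)^{n+1} dz`.
[folklore] -/
private theorem inner_integral_rvF_z (a b k s j q n : ℕ) (x y : ℝ) :
    ∫ z in (0:ℝ)..1, rvF a b k s j q n x y z =
      (x ^ a * (1 - x) ^ b * y ^ k * (1 - y) ^ s) *
        ∫ z in (0:ℝ)..1, z ^ j * (1 - z) ^ q / (1 - (1 - x * y) * z) ^ (n + 1) := by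
  rw [← intervalIntegral.integral_const_mul]
  refine intervalIntegral.integral_congr fun z _ => ?_
  simp only [rvF]
  ring

/-- **The inner identity in `z`**: for `(x,y) ∈ (0,1)²` and `n ≤ j + q`,
`n!(j+q−n)! ∫₀¹ rvF(a,b,k,s,j,q;n) dz = j! q! ∫₀¹ rvF(a,b,k,s,n,j+q−n;j) dz` (Euler's exchange in `z`, with
`w = 1 − xy`). [cite: RhinViola2001, §4 p. 281 (the integral transformation in `z`)] -/
private theorem inner_exchange_z (a b k s j q n : ℕ) (hn : n ≤ j + q) {x y : ℝ}
    (hx0 : 0 < x) (hx1 : x < 1) (hy0 : 0 < y) (hy1 : y < 1) :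
    ((n ! : ℝ) * ((j + q - n) ! : ℝ)) * ∫ z in (0:ℝ)..1, rvF a b k s j q n x y z =
      ((j ! : ℝ) * (q ! : ℝ)) * ∫ z in (0:ℝ)..1, rvF a b k s n (j + q - n) j x y z := by
  rw [inner_integral_rvF_z a b k s j q n x y, inner_integral_rvF_z a b k s n (j + q - n) j x y]
  have hw : 1 - x * y < 1 := by nlinarith [mul_pos hx0 hy0]
  have _ := hx1
  have _ := hy1
  have hE := euler_exchange j q n hn hw
  set K := x ^ a * (1 - x) ^ b * y ^ k * (1 - y) ^ s
  linear_combination K * hE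

/-- The inner identity in `z` at the level of lower Lebesgue integrals.
[cite: RhinViola2001, §4 p. 281 (the integral transformation in `z`)] -/
private theorem inner_lintegral_exchange_z (a b k s j q n : ℕ) (hn : n ≤ j + q)
    {x y : ℝ} (hx : x ∈ Ioo (0 : ℝ) 1) (hy : y ∈ Ioo (0 : ℝ) 1) :
    ∫⁻ z in Ioo (0 : ℝ) 1, ENNReal.ofReal (rvF a b k s j q n x y z) =
      ENNReal.ofReal (((j ! : ℝ) * (q ! : ℝ)) / ((n ! : ℝ) * ((j + q - n) ! : ℝ))) *
        ∫⁻ z in Ioo (0 : ℝ) 1, ENNReal.ofReal (rvF a b k s n (j + q - n) j x y z) := by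
  rw [setLIntegral_Ioo_ofReal' (intervalIntegrable_rvF_z a b k s j q n hx.1 hx.2 hy.1 hy.2)
      (fun z hz => rvF_nonneg_z a b k s j q n hx.1 hx.2 hy.1 hy.2 hz.1.le hz.2.le),
    setLIntegral_Ioo_ofReal' (intervalIntegrable_rvF_z a b k s n (j + q - n) j hx.1 hx.2 hy.1 hy.2)
      (fun z hz => rvF_nonneg_z a b k s n (j + q - n) j hx.1 hx.2 hy.1 hy.2 hz.1.le hz.2.le),
    ← ENNReal.ofReal_mul (by positivity)]
  congr 1
  have hE := inner_exchange_z a b k s j q n hn hx.1 hx.2 hy.1 hy.2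
  have hcd : ((n ! : ℝ) * ((j + q - n) ! : ℝ)) ≠ 0 := by positivity
  field_simp
  linear_combination hE

/-- Iterated-integral (Tonelli) form of a lower Lebesgue integral over `Fin 3 → ℝ` against a product measure,
with the last coordinate innermost (Mathlib's `lmarginal` peeled in the order `0, 1, 2`). [folklore] -/
private theorem lintegral_pi_fin_three_z_inner (ν : Measure ℝ) [SigmaFinite ν]
    {f : (Fin 3 → ℝ) → ENNReal} (hf : Measurable f) :
    ∫⁻ p, f p ∂Measure.pi (fun _ : Fin 3 => ν) = ∫⁻ x, ∫⁻ y, ∫⁻ z, f ![x, y, z] ∂ν ∂ν ∂ν := by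
  rw [lintegral_eq_lmarginal_univ (fun _ => (0 : ℝ))]
  have huniv : (Finset.univ : Finset (Fin 3)) = {0, 1, 2} := by
    ext i; fin_cases i <;> simp
  rw [huniv, lmarginal_insert f hf (i := (0 : Fin 3)) (s := {1, 2}) (by decide)]
  refine lintegral_congr fun x => ?_
  rw [lmarginal_insert f hf (i := (1 : Fin 3)) (s := {2}) (by decide)]
  refine lintegral_congr fun y => ?_
  rw [lmarginal_singleton]
  refine lintegral_congr fun z => ?_
  congr 1
  ext i; fin_cases i <;> simp

/-- **The cube identity in `z`**: `∫⁻_{(0,1)³} rvF(a,b,k,s,j,q;n) = (j!q!/(n!(j+q−n)!)) ∫⁻_{(0,1)³} rvF(a,b,k,s,n,j+q−n;j)`.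
[cite: RhinViola2001, §4 p. 281 (the integral transformation in `z`)] -/
private theorem cube_lintegral_exchange_z (a b k s j q n : ℕ) (hn : n ≤ j + q) :
    ∫⁻ p in cube, ENNReal.ofReal (rvF a b k s j q n (p 0) (p 1) (p 2)) =
      ENNReal.ofReal (((j ! : ℝ) * (q ! : ℝ)) / ((n ! : ℝ) * ((j + q - n) ! : ℝ))) *
        ∫⁻ p in cube, ENNReal.ofReal (rvF a b k s n (j + q - n) j (p 0) (p 1) (p 2)) := by
  have hS : cube = Set.pi univ (fun _ => Ioo (0 : ℝ) 1) := by
    ext p; simp [cube]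
  have hrestrict : (volume : Measure (Fin 3 → ℝ)).restrict cube
      = Measure.pi (fun _ : Fin 3 => (volume : Measure ℝ).restrict (Ioo (0 : ℝ) 1)) := by
    rw [hS, volume_pi, Measure.restrict_pi_pi]
  rw [hrestrict, lintegral_pi_fin_three_z_inner _ (measurable_ofReal_rvF a b k s j q n),
    lintegral_pi_fin_three_z_inner _ (measurable_ofReal_rvF a b k s n (j + q - n) j)]
  simp only [Matrix.cons_val_zero, Matrix.cons_val_one, Matrix.cons_val_two, Matrix.head_cons,
    Matrix.tail_cons]
  rw [← lintegral_const_mul' _ _ ENNReal.ofReal_ne_top]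
  refine setLIntegral_congr_fun measurableSet_Ioo fun x hx => ?_
  rw [← lintegral_const_mul' _ _ ENNReal.ofReal_ne_top]
  refine setLIntegral_congr_fun measurableSet_Ioo fun y hy => ?_
  exact inner_lintegral_exchange_z a b k s j q n hn hx hy

/-- **The hypergeometric transformation in `z` — PROVED** (discharge of the named fact `hypergeometric_z`):
for admissible parameters, `I(h,j,k,l,m,q,r,s) = j! q!/(q'! j'!) · I(h, q', k, l, m, j', r, s)`, `q' = q+h−r`,
`j' = j+r−h`, by Euler's exchange in the variable `z` (`w = 1 − xy`), Tonelli on the cube, no integrability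
hypothesis. [cite: RhinViola2001, §4 p. 281 (display before "Let χ denote this hypergeometric transformation")] -/
theorem hypergeometric_z_holds : hypergeometric_z := by
  intro P hP
  obtain ⟨⟨hb1, hb2⟩, hnn, haux⟩ := hP
  obtain ⟨h, j, k, l, m, q, r, s⟩ := P
  simp only [Params.Nonneg, Params.aux] at hnn haux hb1 hb2
  obtain ⟨h0, j0, k0, l0, m0, q0, r0, s0⟩ := hnn
  obtain ⟨-, aj0, -, -, -, aq0, -, -⟩ := haux
  obtain ⟨a, rfl⟩ := Int.eq_ofNat_of_zero_le h0
  obtain ⟨jj, rfl⟩ := Int.eq_ofNat_of_zero_le j0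
  obtain ⟨kk, rfl⟩ := Int.eq_ofNat_of_zero_le k0
  obtain ⟨b, rfl⟩ := Int.eq_ofNat_of_zero_le l0
  obtain ⟨mm, rfl⟩ := Int.eq_ofNat_of_zero_le m0
  obtain ⟨qq, rfl⟩ := Int.eq_ofNat_of_zero_le q0
  obtain ⟨rr, rfl⟩ := Int.eq_ofNat_of_zero_le r0
  obtain ⟨ss, rfl⟩ := Int.eq_ofNat_of_zero_le s0
  set c : ℕ := qq + a - rr with hcdef
  have hn : c ≤ jj + qq := by omega
  have ec : (qq : ℤ) + a - rr = (c : ℤ) := by omega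
  have ed : (jj : ℤ) + mm - kk = ((jj + qq - c : ℕ) : ℤ) := by omega
  have hIP : integrand ⟨a, jj, kk, b, mm, qq, rr, ss⟩ = fun p => rvF a b kk ss jj qq c (p 0) (p 1) (p 2) := by
    funext p
    have e : (qq : ℤ) + a - rr + 1 = ((c + 1 : ℕ) : ℤ) := by omega
    simp only [integrand, rvF, e, zpow_natCast]
  have hIchi : integrand (chi ⟨a, jj, kk, b, mm, qq, rr, ss⟩) =
      fun p => rvF a b kk ss c (jj + qq - c) jj (p 0) (p 1) (p 2) := by
    funext p
    have e : ((jj : ℤ) + mm - kk) + a - rr + 1 = ((jj + 1 : ℕ) : ℤ) := by omega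
    simp only [integrand, chi, Params.aux, rvF]
    rw [e, ec, ed]
    simp only [zpow_natCast]
  have hfj : (jj : ℤ).toNat = jj := Int.toNat_natCast jj
  have hfq : (qq : ℤ).toNat = qq := Int.toNat_natCast qq
  have hfc : ((qq : ℤ) + a - rr).toNat = c := by rw [ec, Int.toNat_natCast]
  have hfd : ((jj : ℤ) + mm - kk).toNat = jj + qq - c := by rw [ed, Int.toNat_natCast]
  simp only [Params.aux, hfj, hfq, hfc, hfd, I]
  rw [hIP, hIchi, integral_cube_rvF, integral_cube_rvF, cube_lintegral_exchange_z a b kk ss jj qq c hn,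
    ENNReal.toReal_mul, ENNReal.toReal_ofReal (by positivity)]
  push_cast
  ring

/-! ### The transformation formula (4.4) for the whole group `Φ`, unconditionally -/

/-- **The transformation formula (4.4) — PROVED for every word in `ϕ, χ, ϑ, σ`**: for admissible parameters,
`I(h,…,s)/(h!⋯s!) = I(ϱ(h),…,ϱ(s))/(ϱ(h)!⋯ϱ(s)!)` — "the value of (4.3) is invariant under the action of the
permutation group `Φ`". This is `GroupStructure.normI_act` fed with the three generator statements now discharged
(`hypergeometric_x_holds`, `hypergeometric_z_holds` in this file; `invariance_theta_holds` in `ThetaInvarianceProofs.lean`;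
`σ` is `invariance_sigma`). [cite: RhinViola2001, §4 (4.4), p. 284] -/
theorem normI_act_holds (w : List Gen) {P : Params} (hP : P.Admissible) : normI (act w P) = normI P :=
  normI_act hypergeometric_x_holds hypergeometric_z_holds invariance_theta_holds w hP

/-- One generator `g ∈ {ϕ, χ, ϑ, σ}`, unconditionally: `I(gP)/∏(gP)! = I(P)/∏P!` for admissible `P`.
[cite: RhinViola2001, §4 (4.4), p. 284] -/
theorem normI_act_gen_holds (g : Gen) {P : Params} (hP : P.Admissible) : normI (g.act P) = normI P :=
  normI_act_gen hypergeometric_x_holds hypergeometric_z_holds invariance_theta_holds g hP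

end Literature.NumberTheory.Irrationality.RhinViola2001

end
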